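import Summits.AtomisticToContinuum.FouriersLaw.Theorems.LocalOhmBVLocalOhmGlue

/-!
# `LocalOhmBV.Assembly` — PROVED

Route `AtomisticToContinuum/FouriersLaw/LocalOhmBV`, assembly item
`stmt-AtomisticToContinuum-13899` (`Assembly`):

  `NessUnique → PinnedSteadyStateExists → FiniteResponseOfUnique → FiniteResponseProfile →
   LocalOhm → BVProfile → BoundedResponseConverges → FouriersLaw`.

The route file carries the planner-authored, sorry-free D-0027 §2.1 deciding theorem
`Summit.AtomisticToContinuum.FouriersLaw.Theses.LocalOhmBV.closes :
  LocalOhmGlue → NessUnique → PinnedSteadyStateExists → FiniteResponseOfUnique →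
  FiniteResponseProfile → LocalOhm → BVProfile → BoundedResponseConverges → FouriersLaw`,
i.e. `Assembly` with the finite-sum glue `LocalOhmGlue` as an extra first antecedent.  That glue
(item stmt-AtomisticToContinuum-12072) is proved in tree as
`Summit.AtomisticToContinuum.FouriersLaw.Theorems.localOhmGlue_proof`
(`Theorems/LocalOhmBVLocalOhmGlue.lean`: summing the local Ohm inequality over the bulk bonds
against the BV bound of the kinetic-temperature response profile gives
`|D_N| ≤ 2 max(C,0)(2ℓ+1) max(C_BV,0)` for `N ≥ 4b+2`, the smaller `N` being finitely many).
This file records the item-closing theorem whose type is the route decl `Assembly` by name: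
`closes` applied to `localOhmGlue_proof`.  No named-fact hypotheses: the theorem is unconditional
(axioms `propext`, `Classical.choice`, `Quot.sound`, those of `closes` and the glue).
-/

namespace Summit.AtomisticToContinuum.FouriersLaw.Theorems

/-- Settles `stmt-AtomisticToContinuum-13899` (assembly of route `LocalOhmBV`): weak steady-state
uniqueness `NessUnique`, clause-(i) existence `PinnedSteadyStateExists`, existence of the
finite-`N` response limits `FiniteResponseOfUnique` and of the kinetic-temperature response
profiles `FiniteResponseProfile`, the two cruxes `LocalOhm` (N-uniform local Ohm inequality) and
`BVProfile` (bounded variation of the response profile), and the import slot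
`BoundedResponseConverges` imply the sub-problem statement `FouriersLaw`.  Proof: the route's
deciding theorem `closes` with its glue antecedent `LocalOhmGlue` discharged by the in-tree
theorem `localOhmGlue_proof` (after unfolding `Assembly`). [folklore] -/
theorem localOhmBV_assembly_proof :
    Summit.AtomisticToContinuum.FouriersLaw.Theses.LocalOhmBV.Assembly := by
  unfold Summit.AtomisticToContinuum.FouriersLaw.Theses.LocalOhmBV.Assembly
  exact Summit.AtomisticToContinuum.FouriersLaw.Theses.LocalOhmBV.closes localOhmGlue_proof

end Summit.AtomisticToContinuum.FouriersLaw.Theorems
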